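import Summits.ResolutionOfSingularities.ResolutionOfSingularities.Theorems.WeightedInvariantContactCylinderPresentationLocal
import Literature.AlgebraicGeometry.Resolution.CobordantBlowupExtReesLocalization
import HarnessLib

/-!
# (P3a-drop), TYPE (a): successors of the cylinder move OVER THE GENERIC POINT of the centre drop whenever the transversal
# P≤2 move drops (door `HypersurfaceCentreConstruction`, stmt-ResolutionOfSingularities-19897; KEY `stub_localWeightedDropEFT4S`,
# rung P3 = `PRung 3`, regime CURVE° of IOTA3-DESIGN v1.3 §8.4; res-type-005, ORDER (o36a) of res-L1-w43-plan-1, RULING gen 11 #2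
# 2026-08-27T12:09:48Z)

Topic: `Summits/ResolutionOfSingularities/ResolutionOfSingularities/Theorems`. Helper for the door item
`HypersurfaceCentreConstruction` (stmt-ResolutionOfSingularities-19897, route `WeightedInvariant`), def-free.  The (drop)
conjunct of the canonical game clause `CanonicalGameClauseLE 3` (`…LocalGameEFT4SDimLE`) at a curve-centre position `(S, f)` —
centre `P`, a family `u` with weights `w` (positively weighted members generating `P`, zero weights on the cylinder
directions: `…ContactCylinderPresentationLocal`, p529238), cobordant algebra `B = cobordantAlgebra' u w`, successor primes
`𝔫 ⊂ B` with `t⁻¹ ∈ 𝔫`, `P·B ≤ 𝔫`, `𝔫 ⊉ vertex` — splits by `𝔫 ∩ S` (res-type-092's O36-DESIGN §2): TYPE (a) `𝔫 ∩ S = P`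
(the successor lies over the generic point of the centre) and TYPE (b) `𝔫 ∩ S = 𝔪` (over the special point).  This file
proves the TYPE (a) half for EVERY iso-invariant `ι`, every ring `S` and every presentation of the localised filtration:

**`iota_successor_lt_of_over_generic_point`** — if the (drop) conjunct holds at the localised position `(S_P, f/1)` for its
cobordant algebra `B' = extReesAlgebra I'`, `I'ₘ = 𝒥ₘ(u, w)·S_P` (ANY such `I'`, so the P≤2 clause's own presentation can be
plugged in: equal filtrations have equal carriers), if `ι (S_P) (f/1) = ι S f` (the position lies on the top `ι`-stratum
through `P`), and if the pieces `𝒥ₘ(u, w)` are contracted from `S_P` (`(𝒥ₘ S_P) ∩ S = 𝒥ₘ` — primary to the centre: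
res-type-005's `comap_map_weightedMonomialIdeal_eq_of_linearIndependent`, p521270, with the zero-weight padding of p529238), THEN
`ι (B_𝔫) (g/1) < ι S f` for every successor prime `𝔫` of TYPE (a) and every `t⁻¹`-primitive transform `f = (t⁻¹)^a g`,
`g/1 ∈ 𝔪_{B_𝔫}²`.

Route (all bookkeeping on the tree's Włodarczyk layer): the coefficientwise model `⊕ 𝒥ₘ tᵐ` of `B` (bridge
`IdealFiltration.exists_ringEquiv_extReesAlgebra`, …ExtReesBridge), localisation of extended Rees algebras at `M = S ∖ P`
(…ExtReesLocalization §5: `isPrime_map_extendedReesMap`, `exists_ringEquiv_localization_extReesAlgebra` with its dictionary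
`tInv_mem_iff_T_mem` / `vertexIdeal_le_iff_irrelevant_le` / `map_algebraMap_le_iff_map_algebraMap_le`), giving a ring map
`ψ : B → B'` and an isomorphism of local rings `B_𝔫 ≅ B'_{𝔫'}` over it; `t⁻¹`-primitivity of `ψ g` is the one non-formal point
— `t⁻¹ ∣ p` in `⊕ 𝒥ₘ tᵐ` is a COEFFICIENT condition (`tInv_dvd_iff_forall_coeff_mem`: `p_{m−1} ∈ 𝒥ₘ` for all
`m`), preserved backwards along `S → S_P` exactly because the `𝒥ₘ` are contracted; finally (c6) `IotaIsoInvariant ι` along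
`B_𝔫 ≅ B'_{𝔫'}`.  [OURS · L1 W4.3 · (o36a)]  Replaces the role of NO printed item; NOT a statement of the manuscript
[claim: Hironaka2017, status: under-review]. AI work, weaker than expert review.

## References

* J. Włodarczyk, Functorial resolution by torus actions (cobordant blow-ups), arXiv:2203.03090, Def. 2.3.5, Lemma 2.3.8,
  App. Def. 5.1.1. [Wlodarczyk2022]
* H. Matsumura, Commutative Ring Theory (1987), §4 (localisation; primes of `M⁻¹A`). [Matsumura1987]
* res-type-092, `plan/tools/res-type-092/o36/O36-DESIGN.md` §2 (type (a)/(b) split); res-L1-w43-plan-1, IOTA3-DESIGN v1.3 §8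
  (OURS, AI planning).
-/

noncomputable section

open IsLocalRing Literature.AlgebraicGeometry.Resolution
open Summit.ResolutionOfSingularities.ResolutionOfSingularities.Cruxes.HypersurfaceCentreConstruction.LocalEngine
open scoped LaurentPolynomial
open LaurentPolynomial

set_option linter.dupNamespace false -- mandated namespace of this single-conjunct summit

namespace Summit.ResolutionOfSingularities.ResolutionOfSingularities.Theorems

namespace ContactCylinder

/-! ## §1 Divisibility by `t⁻¹` in `⊕ 𝒥ₘ tᵐ` is a coefficient condition -/

section Coeff

variable {A : Type} [CommRing A]

/-- Coefficients of `p · tᵐ`: `(p tᵐ)_n = p_{n−m}`. [folklore] -/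
theorem coeff_mul_T (p : A[T;T⁻¹]) (m n : ℤ) : (p * T m).coeff n = p.coeff (n - m) := by
  rw [T, AddMonoidAlgebra.coeff_mul_single_apply, mul_one, sub_eq_add_neg]

/-- **`t⁻¹ ∣ p` in `⊕ 𝒥ₘ tᵐ` iff `p_{m−1} ∈ 𝒥ₘ` for every `m ≥ 0`** (the quotient is `p·t`, which must again satisfy the
coefficient conditions). [cite: Wlodarczyk2022, App. Def. 5.1.1] -/
theorem tInv_dvd_iff_forall_coeff_mem (F : IdealFiltration A) (p : F.extendedRees) :
    (⟨T (-1), F.T_neg_one_mem_extendedRees⟩ : F.extendedRees) ∣ p ↔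
      ∀ m : ℕ, (p : A[T;T⁻¹]).coeff ((m : ℤ) - 1) ∈ F.ideal m := by
  constructor
  · rintro ⟨h, hp⟩ m
    have hcoe : (p : A[T;T⁻¹]) = (h : A[T;T⁻¹]) * T (-1) := by
      rw [hp, Subalgebra.coe_mul, T_mul]
    rw [hcoe, coeff_mul_T, sub_neg_eq_add, sub_add_cancel]
    exact (F.mem_extendedRees_iff.mp h.2) m
  · intro hc
    refine ⟨⟨(p : A[T;T⁻¹]) * T 1, F.mem_extendedRees_iff.mpr fun m => ?_⟩, ?_⟩
    · rw [coeff_mul_T]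
      exact hc m
    · apply Subtype.ext
      rw [Subalgebra.coe_mul]
      change (p : A[T;T⁻¹]) = T (-1) * ((p : A[T;T⁻¹]) * T 1)
      rw [T_mul, mul_assoc, ← T_add, show (1 : ℤ) + -1 = 0 by norm_num, T_zero, mul_one]

end Coeff

/-! ## §2 Local rings at corresponding primes: transport of `ι` and of `𝔪ᵏ` (small carriers first)

The comparison isomorphisms of local rings produced by the Włodarczyk layer are typed over the concrete `Localization`
instances; the two lemmas below are stated over the SAME binder shape, so that they apply to those isomorphisms by syntactic
unification (no unfolding of the `Localization`/`OreLocalization` instance chain at the large carriers of §3). -/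

section Small

variable {B B' : Type} [CommRing B] [CommRing B'] (𝔫 : Ideal B) [𝔫.IsPrime] (𝔫' : Ideal B') [𝔫'.IsPrime]

/-- (c6) along an isomorphism of local rings at primes: `ι (B'_{𝔫'}) (Φ x) = ι (B_𝔫) x`. [folklore] -/
theorem iota_ringEquiv_atPrime {ι : (R : Type) → [CommRing R] → R → Ordinal.{0}} (hι : IotaIsoInvariant ι)
    (Φ : Localization.AtPrime 𝔫 ≃+* Localization.AtPrime 𝔫') (x : Localization.AtPrime 𝔫) :
    ι (Localization.AtPrime 𝔫') (Φ x) = ι (Localization.AtPrime 𝔫) x :=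
  hι _ _ Φ x

/-- An isomorphism of local rings at primes carries `𝔪ᵏ` into `𝔪'ᵏ`. [folklore] -/
theorem mem_maximalIdeal_pow_of_ringEquiv_atPrime (Φ : Localization.AtPrime 𝔫 ≃+* Localization.AtPrime 𝔫')
    {x : Localization.AtPrime 𝔫} {k : ℕ} (hx : x ∈ maximalIdeal (Localization.AtPrime 𝔫) ^ k) :
    Φ x ∈ maximalIdeal (Localization.AtPrime 𝔫') ^ k := by
  have h := Ideal.mem_map_of_mem Φ hx
  rwa [Ideal.map_pow, IsLocalRing.map_ringEquiv_maximalIdeal] at h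

end Small

/-! ## §3 TYPE (a): successors over the generic point of the centre -/

section Generic

set_option maxHeartbeats 400000 in -- one decl: the comparison isomorphisms of local rings carry large carrier types
/-- **(o36a) TYPE (a) OF (P3a-drop): SUCCESSORS OVER THE GENERIC POINT DROP WHEN THE TRANSVERSAL MOVE DROPS.**
`S` a ring with a prime `P`, `u : Fin n → S` with weights `w`, `B = cobordantAlgebra' u w`, `S' = S_P`, and `I'ₘ = 𝒥ₘ(u,w)·S'`
(any presentation; `B' = extReesAlgebra I'`).  Hypotheses: (c6) for `ι`; the pieces `𝒥ₘ(u, w)` are contracted from `S'`; `f` lies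
on the top `ι`-stratum through `P` (`ι (S') (f/1) = ι S f`); and the (drop) conjunct of the canonical game clause at
`(S', f/1)` over `B'` with centre prime `P S'` (literal binders: `t⁻¹ ∈ 𝔫'`, `(P S')·B' ≤ 𝔫'`, `𝔫' ⊉ vertex`,
`f/1 = (t⁻¹)^a g'`, `t⁻¹ ∤ g'`, `g'/1 ∈ 𝔪_{B'_{𝔫'}}²`).  Conclusion: for every successor prime `𝔫 ⊂ B` with `t⁻¹ ∈ 𝔫`,
`P·B ≤ 𝔫`, `𝔫 ⊉ vertex` and `𝔫 ∩ S ⊆ P` (TYPE (a)), and every `f = (t⁻¹)^a g` in `B` with `t⁻¹ ∤ g` and `g/1 ∈ 𝔪_{B_𝔫}²`: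
**`ι (B_𝔫) (g/1) < ι S f`**. [OURS · L1 W4.3 · (o36a)] -/
theorem iota_successor_lt_of_over_generic_point
    {ι : (R : Type) → [CommRing R] → R → Ordinal.{0}} (hι : IotaIsoInvariant ι)
    (S : Type) [CommRing S] {n : ℕ} (u : Fin n → S) (w : Fin n → ℕ) (P : Ideal S) [P.IsPrime]
    (I' : ℕ → Ideal (Localization.AtPrime P))
    (hI' : ∀ m, I' m = (weightedMonomialIdeal u w m).map (algebraMap S (Localization.AtPrime P)))
    (hcontr : ∀ m, ((weightedMonomialIdeal u w m).map (algebraMap S (Localization.AtPrime P))).comap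
      (algebraMap S (Localization.AtPrime P)) = weightedMonomialIdeal u w m)
    (f : S) (hιP : ι (Localization.AtPrime P) (algebraMap S (Localization.AtPrime P) f) = ι S f)
    (hdrop : ∀ (𝔫' : Ideal (extReesAlgebra I')) [𝔫'.IsPrime], extReesAlgebra.tInv I' ∈ 𝔫' →
      (P.map (algebraMap S (Localization.AtPrime P))).map
          (algebraMap (Localization.AtPrime P) (extReesAlgebra I')) ≤ 𝔫' →
      ¬ extReesAlgebra.vertexIdeal I' ≤ 𝔫' →
      ∀ (a : ℕ) (g' : extReesAlgebra I'),
        algebraMap (Localization.AtPrime P) (extReesAlgebra I') (algebraMap S (Localization.AtPrime P) f) =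
          extReesAlgebra.tInv I' ^ a * g' →
        ¬ extReesAlgebra.tInv I' ∣ g' →
        algebraMap (extReesAlgebra I') (Localization.AtPrime 𝔫') g' ∈ maximalIdeal (Localization.AtPrime 𝔫') ^ 2 →
        ι (Localization.AtPrime 𝔫') (algebraMap (extReesAlgebra I') (Localization.AtPrime 𝔫') g') <
          ι (Localization.AtPrime P) (algebraMap S (Localization.AtPrime P) f))
    (𝔫 : Ideal (cobordantAlgebra' u w)) [𝔫.IsPrime] (hT : cobordantT' u w ∈ 𝔫)
    (hP𝔫 : P.map (algebraMap S (cobordantAlgebra' u w)) ≤ 𝔫)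
    (hV : ¬ extReesAlgebra.vertexIdeal (weightedMonomialIdeal u w) ≤ 𝔫)
    (hgen : 𝔫.comap (algebraMap S (cobordantAlgebra' u w)) ≤ P)
    (a : ℕ) (g : cobordantAlgebra' u w) (hfg : algebraMap S (cobordantAlgebra' u w) f = cobordantT' u w ^ a * g)
    (hTg : ¬ cobordantT' u w ∣ g)
    (hg2 : algebraMap (cobordantAlgebra' u w) (Localization.AtPrime 𝔫) g ∈ maximalIdeal (Localization.AtPrime 𝔫) ^ 2) :
    ι (Localization.AtPrime 𝔫) (algebraMap (cobordantAlgebra' u w) (Localization.AtPrime 𝔫) g) < ι S f := by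
  -- the weighted filtration of `(u, w)` and its localised companion with pieces `I'` (both kept ABSTRACT: only their
  -- pieces matter, and opaque carriers keep the local-ring types small for the kernel)
  obtain ⟨W, hW⟩ : ∃ W : IdealFiltration S, W.ideal = weightedMonomialIdeal u w :=
    ⟨weightedFiltration u w, (weightedMonomialIdeal_eq_weightedFiltration_ideal' u w).symm⟩
  obtain ⟨F', hF'I⟩ : ∃ F' : IdealFiltration (Localization.AtPrime P), F'.ideal = I' :=
    ⟨{ ideal := I'
       ideal_zero := by rw [hI' 0, weightedMonomialIdeal_zero, Ideal.map_top]
       antitone := fun m m' h => by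
         rw [hI' m, hI' m']
         exact Ideal.map_mono (weightedMonomialIdeal_antitone u w h)
       mul_le := fun m m' => by
         rw [hI' m, hI' m', hI' (m + m'), ← Ideal.map_mul, ← hW]
         exact Ideal.map_mono (W.mul_le m m') }, rfl⟩
  have heq : ∀ m, F'.ideal m = (W.ideal m).map (algebraMap S (Localization.AtPrime P)) :=
    fun m => by rw [hF'I, hW]; exact hI' m
  -- the coefficient models of `B` and `B'`
  obtain ⟨e₀, he₀⟩ := W.exists_ringEquiv_extReesAlgebra hW
  obtain ⟨e', he'⟩ := F'.exists_ringEquiv_extReesAlgebra hF'I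
  -- the prime `𝔫₁ = e₀ 𝔫` of `⊕ 𝒥ₘ tᵐ` misses `M = S ∖ P`
  have h𝔫₁ : (𝔫.map e₀).comap e₀ = 𝔫 := Ideal.comap_map_of_bijective e₀ e₀.bijective
  have hd : Disjoint ((P.primeCompl.map (algebraMap S W.extendedRees) :
      Submonoid W.extendedRees) : Set W.extendedRees) (𝔫.map e₀ : Set _) := by
    rw [Set.disjoint_left]
    rintro _ ⟨s, hs, rfl⟩ hmem
    apply hs
    apply hgen
    have h2 : algebraMap S (cobordantAlgebra' u w) s ∈ (𝔫.map e₀).comap e₀ := by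
      rw [Ideal.mem_comap, apply_algebraMap_eq e₀ he₀]
      exact hmem
    rw [h𝔫₁] at h2
    exact Ideal.mem_comap.mpr h2
  -- the game side over `S_P` at the extended prime
  haveI := W.isPrime_map_extendedReesMap F' P.primeCompl heq (𝔫.map e₀) hd
  obtain ⟨g₁, hg₁⟩ :=
    W.exists_ringEquiv_localization_extReesAlgebra F' P.primeCompl heq (𝔫.map e₀) hd e'
  obtain ⟨f₁, hf₁⟩ := W.exists_ringEquiv_localization e₀ 𝔫
  -- the ring map `ψ : B → B'` under the comparison of local rings
  have hΦ : ∀ b : cobordantAlgebra' u w,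
      g₁ (f₁ (algebraMap (cobordantAlgebra' u w) (Localization.AtPrime 𝔫) b)) =
        algebraMap (extReesAlgebra I') _
          (e'.symm (W.extendedReesMap F' (fun m => (heq m).ge) (e₀ b))) := fun b => by
    rw [hf₁, hg₁]
  have hψT : e'.symm (W.extendedReesMap F' (fun m => (heq m).ge) (e₀ (cobordantT' u w))) = extReesAlgebra.tInv I' := by
    change e'.symm (W.extendedReesMap F' (fun m => (heq m).ge) (e₀ (extReesAlgebra.tInv _))) = _
    rw [W.ringEquiv_tInv e₀ he₀, W.extendedReesMap_T F' (fun m => (heq m).ge),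
      ← F'.ringEquiv_tInv e' he', e'.symm_apply_apply]
  have hψS : ∀ s : S, e'.symm (W.extendedReesMap F' (fun m => (heq m).ge) (e₀ (algebraMap S _ s))) =
      algebraMap (Localization.AtPrime P) (extReesAlgebra I') (algebraMap S (Localization.AtPrime P) s) := fun s => by
    rw [apply_algebraMap_eq e₀ he₀, W.extendedReesMap_algebraMap F' (fun m => (heq m).ge),
      ← apply_algebraMap_eq e'.symm (coe_symm_apply_eq e' he')]
  -- dictionary at the prime `𝔫'`
  have hT' : extReesAlgebra.tInv I' ∈
      ((𝔫.map e₀).map (W.extendedReesMap F' (fun m => (heq m).ge))).map e'.symm := by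
    refine (W.tInv_mem_iff_T_mem F' P.primeCompl heq (𝔫.map e₀) hd e' he').mpr ?_
    rw [← W.ringEquiv_tInv e₀ he₀]
    exact Ideal.mem_map_of_mem e₀ hT
  have hV' : ¬ extReesAlgebra.vertexIdeal I' ≤
      ((𝔫.map e₀).map (W.extendedReesMap F' (fun m => (heq m).ge))).map e'.symm := by
    rw [W.vertexIdeal_le_iff_irrelevant_le F' P.primeCompl heq (𝔫.map e₀) hd e' he' hF'I,
      W.irrelevant_le_iff_vertexIdeal_le_comap e₀ he₀ hW (𝔫.map e₀), h𝔫₁]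
    exact hV
  have hP' : (P.map (algebraMap S (Localization.AtPrime P))).map (algebraMap _ (extReesAlgebra I')) ≤
      ((𝔫.map e₀).map (W.extendedReesMap F' (fun m => (heq m).ge))).map e'.symm := by
    rw [W.map_algebraMap_le_iff_map_algebraMap_le F' P.primeCompl heq (𝔫.map e₀) hd e' he' P,
      ← map_map_algebraMap_eq e₀ he₀ P]
    exact Ideal.map_mono hP𝔫
  -- the transform upstairs: `f/1 = (t⁻¹)^a · ψ g`, `ψ g` is `t⁻¹`-primitive and singular at `𝔫'`
  have hfg' : algebraMap (Localization.AtPrime P) (extReesAlgebra I') (algebraMap S (Localization.AtPrime P) f) =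
      extReesAlgebra.tInv I' ^ a * e'.symm (W.extendedReesMap F' (fun m => (heq m).ge) (e₀ g)) := by
    rw [← hψS, hfg, map_mul, map_mul, map_mul, map_pow, map_pow, map_pow, hψT]
  have hTg' : ¬ extReesAlgebra.tInv I' ∣ e'.symm (W.extendedReesMap F' (fun m => (heq m).ge) (e₀ g)) := by
    intro hdvd
    apply hTg
    -- divisibility by `t⁻¹` is a coefficient condition, upstairs and downstairs
    have h1 : (⟨T (-1), F'.T_neg_one_mem_extendedRees⟩ : F'.extendedRees) ∣
        W.extendedReesMap F' (fun m => (heq m).ge) (e₀ g) := by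
      rw [← F'.ringEquiv_tInv e' he', ← e'.apply_symm_apply (W.extendedReesMap F' (fun m => (heq m).ge) (e₀ g))]
      exact map_dvd e' hdvd
    rw [tInv_dvd_iff_forall_coeff_mem F'] at h1
    have h3 : (⟨T (-1), W.T_neg_one_mem_extendedRees⟩ : W.extendedRees) ∣
        e₀ g := by
      rw [tInv_dvd_iff_forall_coeff_mem W]
      intro m
      have hm : ((W.extendedReesMap F' (fun m => (heq m).ge) (e₀ g) : F'.extendedRees) :
          (Localization.AtPrime P)[T;T⁻¹]).coeff ((m : ℤ) - 1) ∈ I' m := (congrFun hF'I m) ▸ h1 m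
      rw [IdealFiltration.coe_extendedReesMap, AddMonoidAlgebra.coeff_mapRingHom, he₀, hI' m] at hm
      have hm' : ((g : cobordantAlgebra' u w) : S[T;T⁻¹]).coeff ((m : ℤ) - 1) ∈
          ((weightedMonomialIdeal u w m).map (algebraMap S (Localization.AtPrime P))).comap
            (algebraMap S (Localization.AtPrime P)) := Ideal.mem_comap.mpr hm
      rw [hcontr m] at hm'
      rw [he₀, hW]
      exact hm'
    have h4 := map_dvd e₀.symm h3
    rwa [← W.ringEquiv_tInv e₀ he₀, e₀.symm_apply_apply, e₀.symm_apply_apply] at h4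
  have hg2' : algebraMap (extReesAlgebra I') (Localization.AtPrime
        (((𝔫.map e₀).map (W.extendedReesMap F' (fun m => (heq m).ge))).map e'.symm))
        (e'.symm (W.extendedReesMap F' (fun m => (heq m).ge) (e₀ g))) ∈
      maximalIdeal _ ^ 2 := by
    -- two hops: along `f₁` (to the coefficient model of `B`) and along `g₁` (to the game side over `S_P`)
    have h := mem_maximalIdeal_pow_of_ringEquiv_atPrime _ _ g₁ (mem_maximalIdeal_pow_of_ringEquiv_atPrime _ _ f₁ hg2)
    rw [hΦ g] at h
    exact h
  -- the drop downstairs, transported along `B_𝔫 ≅ (⊕𝒥ₘtᵐ)_{𝔫₁} ≅ B'_{𝔫'}` by (c6), in two hops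
  have hlt := hdrop _ hT' hP' hV' a _ hfg' hTg' hg2'
  have key₁ := iota_ringEquiv_atPrime _ _ hι f₁ (algebraMap (cobordantAlgebra' u w) (Localization.AtPrime 𝔫) g)
  have key₂ := iota_ringEquiv_atPrime _ _ hι g₁ (f₁ (algebraMap (cobordantAlgebra' u w) (Localization.AtPrime 𝔫) g))
  rw [hΦ g, key₁] at key₂
  rw [key₂, hιP] at hlt
  exact hlt

end Generic

/-! ## §4 The contractedness hypothesis at a P3a presentation (zero weights on the cylinder directions) -/

section Contracted

variable {S : Type} [CommRing S]

/-- **Weight-`0` padding does not change the weighted pieces** (general positively weighted head `(v; wv)`):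
`(v, y; wv, 0)_m = (v; wv)_m`. [cite: Wlodarczyk2022, Lemma 2.1.12] -/
theorem weightedMonomialIdeal_append_zero' {c r : ℕ} (v : Fin c → S) (wv : Fin c → ℕ) (y : Fin r → S) (m : ℕ) :
    weightedMonomialIdeal (Fin.append v y) (Fin.append wv (fun _ : Fin r => 0)) m = weightedMonomialIdeal v wv m := by
  rw [weightedMonomialIdeal_eq_comp_of_forall_mem_range (Fin.append v y) (Fin.append wv fun _ => 0)
    (Fin.castAdd r) (Fin.castAdd_injective c r) ?_ m]
  · have hu : Fin.append v y ∘ Fin.castAdd r = v := funext fun j => by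
      simp only [Function.comp_apply, Fin.append_left]
    have hw : (Fin.append wv fun _ : Fin r => 0) ∘ Fin.castAdd r = wv := funext fun j => by
      simp only [Function.comp_apply, Fin.append_left]
    rw [hu, hw]
  · intro i hi
    induction i using Fin.addCases with
    | left j => exact ⟨j, rfl⟩
    | right j =>
      rw [Fin.append_right] at hi
      exact absurd hi (lt_irrefl 0)

/-- **The pieces of a P3a presentation are contracted from `S_P`**: for `v ⊆ P` with independent differentials and positive
weights `wv`, padded by cylinder directions `y` of weight `0`, `((v, y; wv, 0)_m · S_P) ∩ S = (v, y; wv, 0)_m` — the hypothesis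
`hcontr` of `iota_successor_lt_of_over_generic_point` (res-type-005's `comap_map_weightedMonomialIdeal_eq_of_linearIndependent`,
p521270, after padding). [OURS · L1 W4.3 · (o36a)] -/
theorem comap_map_weightedMonomialIdeal_append_zero [IsRegularLocalRing S] (P : Ideal S) [P.IsPrime] {c r : ℕ}
    (v : Fin c → S) (hv : ∀ i, v i ∈ maximalIdeal S)
    (hli : LinearIndependent (ResidueField S) (fun i => (maximalIdeal S).toCotangent ⟨v i, hv i⟩))
    (hvP : ∀ i, v i ∈ P) (wv : Fin c → ℕ) (hwv : ∀ i, 0 < wv i) (y : Fin r → S) (m : ℕ) :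
    ((weightedMonomialIdeal (Fin.append v y) (Fin.append wv (fun _ : Fin r => 0)) m).map
        (algebraMap S (Localization.AtPrime P))).comap (algebraMap S (Localization.AtPrime P)) =
      weightedMonomialIdeal (Fin.append v y) (Fin.append wv (fun _ : Fin r => 0)) m := by
  rw [weightedMonomialIdeal_append_zero']
  rcases Nat.eq_zero_or_pos m with rfl | hm
  · rw [weightedMonomialIdeal_zero, Ideal.map_top, Ideal.comap_top]
  · exact comap_map_weightedMonomialIdeal_eq_of_linearIndependent P v hv hli hvP wv hwv hm

end Contracted

end ContactCylinder

end Summit.ResolutionOfSingularities.ResolutionOfSingularities.Theorems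

end
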